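import Summits.QuantumFields.YangMills.Theorems.BalabanUVNodesN11NoExpansionDiagonalAtZ
import Summits.QuantumFields.YangMills.Theorems.BalabanUVNodesN11ResidualPinCompletion
import Literature.MathematicalPhysics.QuantumFieldTheory.Balaban1983to89.Node00.Record13SepCoPRInhabitedOfSepCoP

/-!
# DAG node N11 — THE NO-EXPANSION DIAGONAL AT THE v1.6 `CoPR` RECORD, AND AT THE CURED RESIDUAL OF RECORD: the level-one and all-large-field level-(k+1)
# (S1ᵀ)₁₃CoPR clauses at `WtOfRecord₁₃R θ p` (run-indexed residual `θ.Zr p`, node00-def-T FILE 25), and — at `θ.Zr p = ZrOfRecord₁₃ θ p` (node00-def-K0a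
# FILE 17) — WITH THE PINS DISCHARGED: the first conjuncts of K1⁶'s 𝐓-law that hold at the cured record from the provisos rows alone (level one) ∕ from the
# S-law and the displayed old-branch data (level k+1)

Cell `pub-ymgap`, YM-PLAN Track A (HUMAN RULING D-0062), seat `pub-ymgap-dag-n11-d` (g7; R134 fan-out seat N11 [B14], strategy s2), route `BalabanUVNodes`
rev 21∕22, item K1⁵ `StabilityBAtRecordR13SepCoP` = stmt-QuantumFields-20294 (helper, count-neutral; the `CoPR` port of this seat's p523822 §1 ∕ p528220 §4 under
dag-lead's ORPHAN rule, keyed on K1⁶ by token after rev 22).  [III] = [Balaban1988Convergent].  Over this seat's `…NoExpansionDiagonalAtZ` (the two ★ theorems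
with the residual `Z` free) and `…ResidualPinCompletion` (uniqueness of the all-large-field index), node00-def-T's `Node00/Record13CoPR` (FILE 25 p529474:
`Stage13RParams`, `Zr`, `WtOfRecord₁₃R`, `SLaw₁₃CoPR`∕`TLaw₁₃CoPR` + `_iff`, `Provisos₁₃CoPR` + `.tstep`) and node00-def-K0a's `Node00/Record13ResidualsR`
(FILE 17 p529638: `seqAllLargeOfRecord`, `ZrOfRecord₁₃` + `localLaws_` ∕ `_quad` ∕ pin faces `_ζ0_zero_univ_pairCfg` ∕ `_ζ0_univ_pairCfgAt`) and
`Node00/Record13SepCoPRInhabitedOfSepCoP` (FILE 18 p531386: the cured embedding `Stage13RParams.ofCured θ₀ := ⟨θ₀, ZrOfRecord₁₃ θ₀⟩` — the K0⁶ witness family —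
with `ofCured_Zr` (`rfl`) and `Stage13Params.Provisos₁₃Core.ofCured`).

WHY THIS FILE.  Director-ym №169 H1 made the residual 𝐓-weight slot run-indexed (`θ.Zr p`, v1.6) so that this seat's cure of FINDING №7 — pin the
generation-`j` factor on `T` to def-T's resummed step weight of THE RUN — is statable as a property of a witness; node00-def-K0a typed the pinned VALUE
`ZrOfRecord₁₃ θ p` (№174 (5)).  §1 instantiates `…DiagonalAtZ` at `Z := θ.Zr p` (the `CoPR` weights are `tkWeightsOfRecordP … (θ.Zr p)` by `rfl`), reading the
S-side hypothesis through `sLaw₁₃CoPR_iff`.  §2 is the payoff: at a v1.6 parameter whose run-`p` residual IS K0a's (`θ.Zr p = ZrOfRecord₁₃ θ.toStage13Params p`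
— K0a's cured witnesses `Stage13RParams.ofCured` satisfy it by `rfl`), the pin hypotheses `hZ` ∕ `hq` ∕ `hloc` of §1 are K0a's faces (after this seat's
`seq_eq_seqAllLargeOfRecord` identifies the `hall`-sequence with K0a's index), unity of def-T's `ζ` and the joint measurability of `w_k(s′)` are the provisos rows
`zetaUnity` ∕ `measω` (`Provisos₁₃CoPR.tstep … .measW`): the LEVEL-ONE clause holds outright (`0 < K`, `1 ≤ M`, provisos), the level-(k+1) clause along the
all-large-field history holds given `SLaw₁₃CoPR θ p k` and the displayed measurability ∕ bound of the old branch.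

WHAT THIS FILE PROVES (0 `sorry`, 0 `def`, standard axioms; `N`-generic).  §1 `WtOfRecord₁₃R_eq_tkWeightsOfRecordP` (`rfl` face) ·
`slotsT_one_ae_eq_sect2Slot_CoPR_of_zeta0_pin` · `hasSect2FormAtZ_clause_one_CoPR_of_zeta0_pin` · `hasSect2FormAtZ_clause_succ_CoPR_of_allLarge_pin`.
§2 ★★ `slotsT_one_ae_eq_sect2Slot_CoPR_of_Zr_eq_ZrOfRecord` · `hasSect2FormAtZ_clause_one_CoPR_of_Zr_eq_ZrOfRecord` (level one at the cured residual: pins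
discharged) · ★★ `hasSect2FormAtZ_clause_one_CoPR_of_provisos` (… and `hζu`∕`hmw` from `Provisos₁₃CoPR`) · ★★ `hasSect2FormAtZ_clause_succ_CoPR_of_Zr_eq_ZrOfRecord`
· `hasSect2FormAtZ_clause_succ_CoPR_of_provisos` (level k+1 along the all-large-field history at the cured residual).  §3 AT K0a's CURED WITNESS FAMILY
`Stage13RParams.ofCured θ₀` (the K0⁶ witnesses): ★★ `hasSect2FormAtZ_clause_one_ofCured_of_provisosCore (h : θ₀.Provisos₁₃Core F N) (hK) (hM) (s) (hΩ) (t)` and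
`hasSect2FormAtZ_clause_succ_ofCured_of_provisosCore (h) (hk) (hM) (hS : SLaw₁₃CoPR (ofCured θ₀) p k) (s hall hmB hCB t')` — stated on `θ₀`'s own objects.

HONEST FRAMING.  These are the NO-EXPANSION conjuncts (one new sequence per level: the all-large-field one) of the (S1ᵀ)₁₃CoPR clause family, at the cured
record; `TLaw₁₃CoPR θ p k` itself quantifies over ALL new sequences and is [III] Theorem 1 ∕ §3 proper (XL; K1's crux, NOT claimed).  The level-(k+1) statement
keeps the S-law `SLaw₁₃CoPR θ p k` (granted to K1 by induction, a HYPOTHESIS here) and the displayed measurability ∕ bound of the old branch (the restricted-averaging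
marginal density is not bounded in the tree).  Nothing of Bałaban's asserted; N11 NOT discharged; counts unmoved (typed 28∕28 · discharged 5∕28).  One finite
four-torus programme at fixed `ε = L^{−K}`; NOT ℝ⁴, NOT OS, NOT a mass gap, NOT Clay.  Sources: [III] Theorem p.245, (1.11) p.248, (2.18) p.257, (2.21)–(2.23)
p.258, (3.16)–(3.21) pp.268–269, (3.24)–(3.25) p.270; FINDING №7∕№8 of this cell (bookkeeping).
-/

noncomputable section

open MeasureTheory
open scoped BigOperators Matrix.Norms.L2Operator

namespace Summit.QuantumFields.YangMills.Theorems.BalabanUVNodesN11NoExpansionDiagonalCoPR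

open Literature.MathematicalPhysics.QuantumFieldTheory.Balaban1983to89 T4Continuum Node00 Node00.Tk DagBinding
open B15DeterminingSets
open BalabanUVNodesN11NoExpansionDiagonalAtZ (slotsT_one_ae_eq_sect2Slot_atZ_of_zeta0_pin hasSect2FormAtZ_clause_succ_atZ_of_allLarge_pin)
open BalabanUVNodesN11ResidualPinCompletion (seq_eq_seqAllLargeOfRecord seq_one_eq_seqAllLargeOfRecord)

variable {F : T4Family} {N : ℕ} [NeZero N]

/-! ## §1. The `CoPR` instances: `Z := θ.Zr p` -/

section CoPR

variable (θ : Stage13RParams F N) (p : B12.RunParams)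

/-- The v1.6 𝐓-weights of the run ARE 12a″'s weights over the run-indexed residual `θ.Zr p` along the ₁₃ history of `θ.toStage13Params` (`rfl`).
[cite: Balaban1988Convergent, (2.21) p.258, (1.11) p.248 (bookkeeping)] -/
theorem WtOfRecord₁₃R_eq_tkWeightsOfRecordP :
    WtOfRecord₁₃R F N θ p = tkWeightsOfRecordP F N (FluctV N) θ.ν θ.A₁ p (gOfRecord₁₃ F N θ.toStage13Params p) (θ.Zr p) := rfl

/-- **★ THE FIRST (S1ᵀ)₁₃CoPR IDENTITY UNDER THE GENERATION-0 PIN ON THE RUN's RESIDUAL** (`…DiagonalAtZ` at `Z := θ.Zr p`): at `Ω₁(s′) = ∅`, if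
`(θ.Zr p).ζ0 0 T (U, V₁) = w(s′)(U, Ū)` and `(θ.Zr p).quad 0 ∅ (U, V₁) = 0`, then `slotT_1(s′) = 𝐓_1(s′)e^{A_1(s′)}` `dV₁`-a.e. at `WtOfRecord₁₃R θ p` and def-R's
support-edition background, `E_1(s′) = E(p)`, every term-value witness. [cite: Balaban1988Convergent, Theorem p.245, (3.25) p.270, (1.11) p.248, (2.21)–(2.23) p.258] -/
theorem slotsT_one_ae_eq_sect2Slot_CoPR_of_zeta0_pin (hK : 0 < p.K) (hM : 1 ≤ θ.τ9.M) (hζu : IsZetaUnity F N θ.ν θ.τ9.M θ.ζ)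
    (s : SeqOfRecord F θ.ν θ.τ9.M (gOfRecord₁₃ F N θ.toStage13Params p) p.K 1) (hΩ : s.Ω 1 = ∅)
    (t : Sect2.TermValues (F.P p.K) (MatA N) (FluctV N) θ.τ9.M)
    (hZ : ∀ (V1 : GaugeField (F.P p.K) 1 (SU N)) (Uf : GaugeField (F.P p.K) 0 (SU N)),
      (θ.Zr p).ζ0 0 Set.univ (pairCfg (V := FluctV N) V1 Uf) =
        wOfRecord₉ F N θ.toStage9Params p (gOfRecord₁₃ F N θ.toStage13Params p) 0 s Uf ((avOfRecord F N p.K 0).avg Uf))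
    (hq : ∀ (V1 : GaugeField (F.P p.K) 1 (SU N)) (Uf : GaugeField (F.P p.K) 0 (SU N)), (θ.Zr p).quad 0 ∅ (pairCfg (V := FluctV N) V1 Uf) = 0)
    (hmw : Measurable fun z : GaugeField (F.P p.K) 1 (SU N) × GaugeField (F.P p.K) 0 (SU N) =>
      wOfRecord₉ F N θ.toStage9Params p (gOfRecord₁₃ F N θ.toStage13Params p) 0 s z.2 z.1) :
    ∀ᵐ V1 ∂fieldMeasure (F.P p.K) 1 (SU N),
      chiSeqOfRecord F N θ.ν θ.τ9.M (gOfRecord₁₃ F N θ.toStage13Params p) p.K 1 s V1 ≠ 0 →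
        slotsTOfRecord F N θ.ν θ.τ9 (EOfRecord₁₃ F N θ.toStage13Params) (wOfRecord₉ F N θ.toStage9Params) θ.ppSel p
            (gOfRecord₁₃ F N θ.toStage13Params p) 1 s V1 =
          sect2Slot F N (FluctV N) p.K (settingOfRecord₁₃ F N θ.toStage13Params p) (θ.Rz p.K) (WtOfRecord₁₃R F N θ p) s t
            (EOfRecord₁₃ F N θ.toStage13Params p) (UbgOfRecord₁₃CoP F N θ.toStage13Params p 1 s) V1 :=
  slotsT_one_ae_eq_sect2Slot_atZ_of_zeta0_pin θ.toStage13Params p (θ.Zr p) hK hM hζu s hΩ t hZ hq hmw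

/-- **… HENCE THE DICHOTOMY CLAUSE `TLaw₁₃CoPR θ p 0` ASKS OF `s′`** (`tLaw₁₃CoPR_iff`; identity branch, witness `(t, E(p))`).
[cite: Balaban1988Convergent, (2.17)–(2.18) p.257, (3.25) p.270, remark p.262] -/
theorem hasSect2FormAtZ_clause_one_CoPR_of_zeta0_pin (hK : 0 < p.K) (hM : 1 ≤ θ.τ9.M) (hζu : IsZetaUnity F N θ.ν θ.τ9.M θ.ζ)
    (s : SeqOfRecord F θ.ν θ.τ9.M (gOfRecord₁₃ F N θ.toStage13Params p) p.K 1) (hΩ : s.Ω 1 = ∅)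
    (t : Sect2.TermValues (F.P p.K) (MatA N) (FluctV N) θ.τ9.M)
    (hZ : ∀ (V1 : GaugeField (F.P p.K) 1 (SU N)) (Uf : GaugeField (F.P p.K) 0 (SU N)),
      (θ.Zr p).ζ0 0 Set.univ (pairCfg (V := FluctV N) V1 Uf) =
        wOfRecord₉ F N θ.toStage9Params p (gOfRecord₁₃ F N θ.toStage13Params p) 0 s Uf ((avOfRecord F N p.K 0).avg Uf))
    (hq : ∀ (V1 : GaugeField (F.P p.K) 1 (SU N)) (Uf : GaugeField (F.P p.K) 0 (SU N)), (θ.Zr p).quad 0 ∅ (pairCfg (V := FluctV N) V1 Uf) = 0)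
    (hmw : Measurable fun z : GaugeField (F.P p.K) 1 (SU N) × GaugeField (F.P p.K) 0 (SU N) =>
      wOfRecord₉ F N θ.toStage9Params p (gOfRecord₁₃ F N θ.toStage13Params p) 0 s z.2 z.1) :
    slotsTOfRecord F N θ.ν θ.τ9 (EOfRecord₁₃ F N θ.toStage13Params) (wOfRecord₉ F N θ.toStage9Params) θ.ppSel p
        (gOfRecord₁₃ F N θ.toStage13Params p) 1 s = 0 ∨
      ∀ᵐ V1 ∂fieldMeasure (F.P p.K) 1 (SU N),
        chiSeqOfRecord F N θ.ν θ.τ9.M (gOfRecord₁₃ F N θ.toStage13Params p) p.K 1 s V1 ≠ 0 →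
          slotsTOfRecord F N θ.ν θ.τ9 (EOfRecord₁₃ F N θ.toStage13Params) (wOfRecord₉ F N θ.toStage9Params) θ.ppSel p
              (gOfRecord₁₃ F N θ.toStage13Params p) 1 s V1 =
            sect2Slot F N (FluctV N) p.K (settingOfRecord₁₃ F N θ.toStage13Params p) (θ.Rz p.K) (WtOfRecord₁₃R F N θ p) s t
              (EOfRecord₁₃ F N θ.toStage13Params p) (UbgOfRecord₁₃CoP F N θ.toStage13Params p 1 s) V1 :=
  Or.inr (slotsT_one_ae_eq_sect2Slot_CoPR_of_zeta0_pin θ p hK hM hζu s hΩ t hZ hq hmw)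

/-- **★★ THE (S1ᵀ)₁₃CoPR,ₖ CLAUSE AT THE ALL-LARGE-FIELD SEQUENCE OF LENGTH k+1 FROM `SLaw₁₃CoPR θ p k` AND THE GENERATION-`k` PIN ON THE RUN's RESIDUAL**
(`…DiagonalAtZ` at `Z := θ.Zr p`, the S-law read through `sLaw₁₃CoPR_iff`): 12b's locality law of `θ.Zr p`, `quad_j(∅) = 0`, the pin
`(θ.Zr p).ζ0 k T (V_k, V_{k+1}) = w_k(s′)(V_k, V̄_k)`, unity of def-T's `ζ`, the displayed measurability ∕ bound of the old branch and joint measurability of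
`w_k(s′)` ⇒ the dichotomy clause at `s′`, `E_{k+1}(s′) = E_k(init s′)`, every term-value witness.
[cite: Balaban1988Convergent, Theorem p.245, (3.24)–(3.25) p.270, (2.18) p.257, (2.20)–(2.23) p.258, (3.16) p.268, (1.11) p.248] -/
theorem hasSect2FormAtZ_clause_succ_CoPR_of_allLarge_pin {k : ℕ} (hk : k < p.K) (hM : 1 ≤ θ.τ9.M) (hζu : IsZetaUnity F N θ.ν θ.τ9.M θ.ζ)
    (hloc : (θ.Zr p).LocalLaws) (hq : ∀ (j : ℕ) (ω : MultiCfg (F.P p.K) (SU N) (FluctV N)), (θ.Zr p).quad j ∅ ω = 0)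
    (hS : SLaw₁₃CoPR F N θ p k)
    (s : SeqOfRecord F θ.ν θ.τ9.M (gOfRecord₁₃ F N θ.toStage13Params p) p.K (k + 1)) (hall : ∀ j, 1 ≤ j → j ≤ k + 1 → s.Ω j = ∅)
    (hZ : ∀ (V' : GaugeField (F.P p.K) (k + 1) (SU N)) (U₀ : GaugeField (F.P p.K) k (SU N)),
      (θ.Zr p).ζ0 k Set.univ (pairCfgAt (V := FluctV N) k V' U₀) =
        wOfRecord₉ F N θ.toStage9Params p (gOfRecord₁₃ F N θ.toStage13Params p) k s U₀ ((avOfRecord F N p.K k).avg U₀))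
    (hmw : Measurable fun z : GaugeField (F.P p.K) (k + 1) (SU N) × GaugeField (F.P p.K) k (SU N) =>
      wOfRecord₉ F N θ.toStage9Params p (gOfRecord₁₃ F N θ.toStage13Params p) k s z.2 z.1)
    {C : ℝ}
    (hmB : ∀ (t : Sect2.TermValues (F.P p.K) (MatA N) (FluctV N) θ.τ9.M) (Ek : ℝ),
      Measurable fun U₀ : GaugeField (F.P p.K) k (SU N) =>
        tkBranchOfRecord F N (FluctV N) θ.ν θ.τ9.M _ p.K (WtOfRecord₁₃R F N θ p) s.init (fun _ => ∅) k
          (fun ω => sect2Operand F N (FluctV N) p.K (settingOfRecord₁₃ F N θ.toStage13Params p) (θ.Rz p.K) s.init t Ek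
            (UbgOfRecord₁₃CoP F N θ.toStage13Params p k s.init) ((fun _ => ∅ : ℕ → Set (Site (F.P p.K) 0)), fun j => (ω j).2) (fun j => (ω j).1))
          (baseCfg (V := FluctV N) k U₀))
    (hCB : ∀ (t : Sect2.TermValues (F.P p.K) (MatA N) (FluctV N) θ.τ9.M) (Ek : ℝ) (U₀ : GaugeField (F.P p.K) k (SU N)),
      |tkBranchOfRecord F N (FluctV N) θ.ν θ.τ9.M _ p.K (WtOfRecord₁₃R F N θ p) s.init (fun _ => ∅) k
          (fun ω => sect2Operand F N (FluctV N) p.K (settingOfRecord₁₃ F N θ.toStage13Params p) (θ.Rz p.K) s.init t Ek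
            (UbgOfRecord₁₃CoP F N θ.toStage13Params p k s.init) ((fun _ => ∅ : ℕ → Set (Site (F.P p.K) 0)), fun j => (ω j).2) (fun j => (ω j).1))
          (baseCfg (V := FluctV N) k U₀)| ≤ C)
    (t' : Sect2.TermValues (F.P p.K) (MatA N) (FluctV N) θ.τ9.M) :
    ∃ Ek' : ℝ,
      slotsTOfRecord F N θ.ν θ.τ9 (EOfRecord₁₃ F N θ.toStage13Params) (wOfRecord₉ F N θ.toStage9Params) θ.ppSel p
          (gOfRecord₁₃ F N θ.toStage13Params p) (k + 1) s = 0 ∨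
        ∀ᵐ V' ∂fieldMeasure (F.P p.K) (k + 1) (SU N),
          chiSeqOfRecord F N θ.ν θ.τ9.M (gOfRecord₁₃ F N θ.toStage13Params p) p.K (k + 1) s V' ≠ 0 →
            slotsTOfRecord F N θ.ν θ.τ9 (EOfRecord₁₃ F N θ.toStage13Params) (wOfRecord₉ F N θ.toStage9Params) θ.ppSel p
                (gOfRecord₁₃ F N θ.toStage13Params p) (k + 1) s V' =
              sect2Slot F N (FluctV N) p.K (settingOfRecord₁₃ F N θ.toStage13Params p) (θ.Rz p.K) (WtOfRecord₁₃R F N θ p) s t' Ek'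
                (UbgOfRecord₁₃CoP F N θ.toStage13Params p (k + 1) s) V' :=
  hasSect2FormAtZ_clause_succ_atZ_of_allLarge_pin θ.toStage13Params p (θ.Zr p) hk hM hζu hloc hq ((sLaw₁₃CoPR_iff F N θ p k).mp hS) s hall hZ
    hmw hmB hCB t'

end CoPR

/-! ## §2. ★★ At the cured residual of record `θ.Zr p = ZrOfRecord₁₃ θ p`: the pins DISCHARGED by K0a's faces -/

section Cured

variable (θ : Stage13RParams F N) (p : B12.RunParams)

/-- **★★ LEVEL ONE AT THE CURED RESIDUAL — PINS DISCHARGED.**  At a v1.6 parameter whose run-`p` residual is node00-def-K0a's `ZrOfRecord₁₃` (its cured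
witnesses `Stage13RParams.ofCured θ₀` by `rfl`) and the new sequence with `Ω₁(s′) = ∅` (which IS the all-large-field index of length `1`), the first (S1ᵀ)₁₃CoPR
identity `slotT_1(s′) = 𝐓_1(s′)e^{A_1(s′)}` holds `dV₁`-a.e. at the run's weights `WtOfRecord₁₃R θ p` and def-R's support-edition background, `E_1(s′) = E(p)`, for
EVERY term-value witness — from unity of def-T's `ζ`, the joint measurability of `w(s′)`, `0 < K`, `1 ≤ M` ONLY (the generation-0 pin and `quad_0(∅) = 0` are
K0a's `ZrOfRecord₁₃_ζ0_zero_univ_pairCfg` ∕ `ZrOfRecord₁₃_quad`).  This is FINDING №7's cure AT A RECORD: with v1.3's weights the same identity was false for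
every residual (`…NoTLawAtAnyRegularity`). [cite: Balaban1988Convergent, Theorem p.245, (3.25) p.270, (1.11) p.248, (3.16)–(3.20) pp.268–269, (2.21)–(2.23) p.258] -/
theorem slotsT_one_ae_eq_sect2Slot_CoPR_of_Zr_eq_ZrOfRecord (hZr : θ.Zr p = ZrOfRecord₁₃ F N θ.toStage13Params p)
    (hK : 0 < p.K) (hM : 1 ≤ θ.τ9.M) (hζu : IsZetaUnity F N θ.ν θ.τ9.M θ.ζ)
    (s : SeqOfRecord F θ.ν θ.τ9.M (gOfRecord₁₃ F N θ.toStage13Params p) p.K 1) (hΩ : s.Ω 1 = ∅)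
    (hmw : Measurable fun z : GaugeField (F.P p.K) 1 (SU N) × GaugeField (F.P p.K) 0 (SU N) =>
      wOfRecord₉ F N θ.toStage9Params p (gOfRecord₁₃ F N θ.toStage13Params p) 0 s z.2 z.1)
    (t : Sect2.TermValues (F.P p.K) (MatA N) (FluctV N) θ.τ9.M) :
    ∀ᵐ V1 ∂fieldMeasure (F.P p.K) 1 (SU N),
      chiSeqOfRecord F N θ.ν θ.τ9.M (gOfRecord₁₃ F N θ.toStage13Params p) p.K 1 s V1 ≠ 0 →
        slotsTOfRecord F N θ.ν θ.τ9 (EOfRecord₁₃ F N θ.toStage13Params) (wOfRecord₉ F N θ.toStage9Params) θ.ppSel p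
            (gOfRecord₁₃ F N θ.toStage13Params p) 1 s V1 =
          sect2Slot F N (FluctV N) p.K (settingOfRecord₁₃ F N θ.toStage13Params p) (θ.Rz p.K) (WtOfRecord₁₃R F N θ p) s t
            (EOfRecord₁₃ F N θ.toStage13Params p) (UbgOfRecord₁₃CoP F N θ.toStage13Params p 1 s) V1 := by
  obtain rfl : s = seqAllLargeOfRecord F θ.ν θ.τ9.M (gOfRecord₁₃ F N θ.toStage13Params p) p.K 1 :=
    seq_one_eq_seqAllLargeOfRecord θ.ν θ.τ9.M _ p.K s hΩ
  refine slotsT_one_ae_eq_sect2Slot_CoPR_of_zeta0_pin θ p hK hM hζu _ hΩ t (fun V1 Uf => ?_) (fun V1 Uf => ?_) hmw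
  · rw [hZr]
    exact ZrOfRecord₁₃_ζ0_zero_univ_pairCfg hK V1 Uf
  · rw [hZr, ZrOfRecord₁₃_quad]

/-- **… HENCE THE LEVEL-ONE DICHOTOMY CLAUSE OF `TLaw₁₃CoPR θ p 0` AT `s′`, AT THE CURED RESIDUAL** (identity branch, witness `(t, E(p))`).
[cite: Balaban1988Convergent, (2.17)–(2.18) p.257, (3.25) p.270, remark p.262] -/
theorem hasSect2FormAtZ_clause_one_CoPR_of_Zr_eq_ZrOfRecord (hZr : θ.Zr p = ZrOfRecord₁₃ F N θ.toStage13Params p)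
    (hK : 0 < p.K) (hM : 1 ≤ θ.τ9.M) (hζu : IsZetaUnity F N θ.ν θ.τ9.M θ.ζ)
    (s : SeqOfRecord F θ.ν θ.τ9.M (gOfRecord₁₃ F N θ.toStage13Params p) p.K 1) (hΩ : s.Ω 1 = ∅)
    (hmw : Measurable fun z : GaugeField (F.P p.K) 1 (SU N) × GaugeField (F.P p.K) 0 (SU N) =>
      wOfRecord₉ F N θ.toStage9Params p (gOfRecord₁₃ F N θ.toStage13Params p) 0 s z.2 z.1)
    (t : Sect2.TermValues (F.P p.K) (MatA N) (FluctV N) θ.τ9.M) :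
    slotsTOfRecord F N θ.ν θ.τ9 (EOfRecord₁₃ F N θ.toStage13Params) (wOfRecord₉ F N θ.toStage9Params) θ.ppSel p
        (gOfRecord₁₃ F N θ.toStage13Params p) 1 s = 0 ∨
      ∀ᵐ V1 ∂fieldMeasure (F.P p.K) 1 (SU N),
        chiSeqOfRecord F N θ.ν θ.τ9.M (gOfRecord₁₃ F N θ.toStage13Params p) p.K 1 s V1 ≠ 0 →
          slotsTOfRecord F N θ.ν θ.τ9 (EOfRecord₁₃ F N θ.toStage13Params) (wOfRecord₉ F N θ.toStage9Params) θ.ppSel p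
              (gOfRecord₁₃ F N θ.toStage13Params p) 1 s V1 =
            sect2Slot F N (FluctV N) p.K (settingOfRecord₁₃ F N θ.toStage13Params p) (θ.Rz p.K) (WtOfRecord₁₃R F N θ p) s t
              (EOfRecord₁₃ F N θ.toStage13Params p) (UbgOfRecord₁₃CoP F N θ.toStage13Params p 1 s) V1 :=
  Or.inr (slotsT_one_ae_eq_sect2Slot_CoPR_of_Zr_eq_ZrOfRecord θ p hZr hK hM hζu s hΩ hmw t)

/-- **★★ THE LEVEL-ONE CLAUSE AT THE CURED RESIDUAL FROM THE PROVISOS ROWS ALONE**: unity of def-T's `ζ` is row `zetaUnity` and the joint measurability of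
`w(s′)` is row `measω` (through `Provisos₁₃CoPR.tstep … .measW`) — so at a cured witness with `Provisos₁₃CoPR`, `0 < K` and `1 ≤ M`, the no-expansion conjunct
of `TLaw₁₃CoPR θ p 0` HOLDS, for every term-value witness, with `E_1(s′) = E(p)`. [cite: Balaban1988Convergent, Theorem p.245, (3.25) p.270, (3.2)–(3.5) pp.264–265, (1.11) p.248] -/
theorem hasSect2FormAtZ_clause_one_CoPR_of_provisos (hZr : θ.Zr p = ZrOfRecord₁₃ F N θ.toStage13Params p) (h : θ.Provisos₁₃CoPR F N)
    (hK : 0 < p.K) (hM : 1 ≤ θ.τ9.M)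
    (s : SeqOfRecord F θ.ν θ.τ9.M (gOfRecord₁₃ F N θ.toStage13Params p) p.K 1) (hΩ : s.Ω 1 = ∅)
    (t : Sect2.TermValues (F.P p.K) (MatA N) (FluctV N) θ.τ9.M) :
    slotsTOfRecord F N θ.ν θ.τ9 (EOfRecord₁₃ F N θ.toStage13Params) (wOfRecord₉ F N θ.toStage9Params) θ.ppSel p
        (gOfRecord₁₃ F N θ.toStage13Params p) 1 s = 0 ∨
      ∀ᵐ V1 ∂fieldMeasure (F.P p.K) 1 (SU N),
        chiSeqOfRecord F N θ.ν θ.τ9.M (gOfRecord₁₃ F N θ.toStage13Params p) p.K 1 s V1 ≠ 0 →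
          slotsTOfRecord F N θ.ν θ.τ9 (EOfRecord₁₃ F N θ.toStage13Params) (wOfRecord₉ F N θ.toStage9Params) θ.ppSel p
              (gOfRecord₁₃ F N θ.toStage13Params p) 1 s V1 =
            sect2Slot F N (FluctV N) p.K (settingOfRecord₁₃ F N θ.toStage13Params p) (θ.Rz p.K) (WtOfRecord₁₃R F N θ p) s t
              (EOfRecord₁₃ F N θ.toStage13Params p) (UbgOfRecord₁₃CoP F N θ.toStage13Params p 1 s) V1 :=
  hasSect2FormAtZ_clause_one_CoPR_of_Zr_eq_ZrOfRecord θ p hZr hK hM h.zetaUnity s hΩ ((h.tstep p 0 hK).measW s) t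

/-- **★★ LEVEL k+1 ALONG THE ALL-LARGE-FIELD HISTORY AT THE CURED RESIDUAL — PINS DISCHARGED.**  At a v1.6 parameter with `θ.Zr p = ZrOfRecord₁₃ θ.toStage13Params p`
and the all-large-field new sequence `s′` of length `k+1` (`k < K`, `1 ≤ M`): 12b's locality law, `quad ≡ 0` and the generation-`k` pin are K0a's
`localLaws_ZrOfRecord₁₃` ∕ `ZrOfRecord₁₃_quad` ∕ `ZrOfRecord₁₃_ζ0_univ_pairCfgAt` (after `seq_eq_seqAllLargeOfRecord`), so the dichotomy clause at `s′` follows from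
`SLaw₁₃CoPR θ p k`, unity of def-T's `ζ`, the joint measurability of `w_k(s′)` and the displayed measurability ∕ bound of the old branch, `E_{k+1}(s′) = E_k(init s′)`.
[cite: Balaban1988Convergent, Theorem p.245, (3.24)–(3.25) p.270, (2.18) p.257, (2.20)–(2.23) p.258, (3.16)–(3.20) pp.268–269, (1.11) p.248] -/
theorem hasSect2FormAtZ_clause_succ_CoPR_of_Zr_eq_ZrOfRecord (hZr : θ.Zr p = ZrOfRecord₁₃ F N θ.toStage13Params p)
    {k : ℕ} (hk : k < p.K) (hM : 1 ≤ θ.τ9.M) (hζu : IsZetaUnity F N θ.ν θ.τ9.M θ.ζ) (hS : SLaw₁₃CoPR F N θ p k)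
    (s : SeqOfRecord F θ.ν θ.τ9.M (gOfRecord₁₃ F N θ.toStage13Params p) p.K (k + 1)) (hall : ∀ j, 1 ≤ j → j ≤ k + 1 → s.Ω j = ∅)
    (hmw : Measurable fun z : GaugeField (F.P p.K) (k + 1) (SU N) × GaugeField (F.P p.K) k (SU N) =>
      wOfRecord₉ F N θ.toStage9Params p (gOfRecord₁₃ F N θ.toStage13Params p) k s z.2 z.1)
    {C : ℝ}
    (hmB : ∀ (t : Sect2.TermValues (F.P p.K) (MatA N) (FluctV N) θ.τ9.M) (Ek : ℝ),
      Measurable fun U₀ : GaugeField (F.P p.K) k (SU N) =>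
        tkBranchOfRecord F N (FluctV N) θ.ν θ.τ9.M _ p.K (WtOfRecord₁₃R F N θ p) s.init (fun _ => ∅) k
          (fun ω => sect2Operand F N (FluctV N) p.K (settingOfRecord₁₃ F N θ.toStage13Params p) (θ.Rz p.K) s.init t Ek
            (UbgOfRecord₁₃CoP F N θ.toStage13Params p k s.init) ((fun _ => ∅ : ℕ → Set (Site (F.P p.K) 0)), fun j => (ω j).2) (fun j => (ω j).1))
          (baseCfg (V := FluctV N) k U₀))
    (hCB : ∀ (t : Sect2.TermValues (F.P p.K) (MatA N) (FluctV N) θ.τ9.M) (Ek : ℝ) (U₀ : GaugeField (F.P p.K) k (SU N)),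
      |tkBranchOfRecord F N (FluctV N) θ.ν θ.τ9.M _ p.K (WtOfRecord₁₃R F N θ p) s.init (fun _ => ∅) k
          (fun ω => sect2Operand F N (FluctV N) p.K (settingOfRecord₁₃ F N θ.toStage13Params p) (θ.Rz p.K) s.init t Ek
            (UbgOfRecord₁₃CoP F N θ.toStage13Params p k s.init) ((fun _ => ∅ : ℕ → Set (Site (F.P p.K) 0)), fun j => (ω j).2) (fun j => (ω j).1))
          (baseCfg (V := FluctV N) k U₀)| ≤ C)
    (t' : Sect2.TermValues (F.P p.K) (MatA N) (FluctV N) θ.τ9.M) :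
    ∃ Ek' : ℝ,
      slotsTOfRecord F N θ.ν θ.τ9 (EOfRecord₁₃ F N θ.toStage13Params) (wOfRecord₉ F N θ.toStage9Params) θ.ppSel p
          (gOfRecord₁₃ F N θ.toStage13Params p) (k + 1) s = 0 ∨
        ∀ᵐ V' ∂fieldMeasure (F.P p.K) (k + 1) (SU N),
          chiSeqOfRecord F N θ.ν θ.τ9.M (gOfRecord₁₃ F N θ.toStage13Params p) p.K (k + 1) s V' ≠ 0 →
            slotsTOfRecord F N θ.ν θ.τ9 (EOfRecord₁₃ F N θ.toStage13Params) (wOfRecord₉ F N θ.toStage9Params) θ.ppSel p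
                (gOfRecord₁₃ F N θ.toStage13Params p) (k + 1) s V' =
              sect2Slot F N (FluctV N) p.K (settingOfRecord₁₃ F N θ.toStage13Params p) (θ.Rz p.K) (WtOfRecord₁₃R F N θ p) s t' Ek'
                (UbgOfRecord₁₃CoP F N θ.toStage13Params p (k + 1) s) V' := by
  obtain rfl : s = seqAllLargeOfRecord F θ.ν θ.τ9.M (gOfRecord₁₃ F N θ.toStage13Params p) p.K (k + 1) :=
    seq_eq_seqAllLargeOfRecord θ.ν θ.τ9.M _ p.K (k + 1) s hall
  refine hasSect2FormAtZ_clause_succ_CoPR_of_allLarge_pin θ p hk hM hζu ?_ (fun j ω => ?_) hS _ hall (fun V' U₀ => ?_) hmw hmB hCB t'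
  · rw [hZr]
    exact localLaws_ZrOfRecord₁₃
  · rw [hZr, ZrOfRecord₁₃_quad]
  · rw [hZr]
    exact ZrOfRecord₁₃_ζ0_univ_pairCfgAt hk V' U₀

/-- **… WITH `hζu` ∕ `hmw` FROM THE PROVISOS ROWS** (`zetaUnity`; `measω` through `Provisos₁₃CoPR.tstep … .measW`): at a cured witness with `Provisos₁₃CoPR`,
the level-(k+1) no-expansion conjunct of `TLaw₁₃CoPR θ p k` along the all-large-field history follows from `SLaw₁₃CoPR θ p k` and the displayed measurability ∕
bound of the old branch (`k < K`, `1 ≤ M`). [cite: Balaban1988Convergent, Theorem p.245, (3.24)–(3.25) p.270, (3.2)–(3.5) pp.264–265] -/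
theorem hasSect2FormAtZ_clause_succ_CoPR_of_provisos (hZr : θ.Zr p = ZrOfRecord₁₃ F N θ.toStage13Params p) (h : θ.Provisos₁₃CoPR F N)
    {k : ℕ} (hk : k < p.K) (hM : 1 ≤ θ.τ9.M) (hS : SLaw₁₃CoPR F N θ p k)
    (s : SeqOfRecord F θ.ν θ.τ9.M (gOfRecord₁₃ F N θ.toStage13Params p) p.K (k + 1)) (hall : ∀ j, 1 ≤ j → j ≤ k + 1 → s.Ω j = ∅)
    {C : ℝ}
    (hmB : ∀ (t : Sect2.TermValues (F.P p.K) (MatA N) (FluctV N) θ.τ9.M) (Ek : ℝ),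
      Measurable fun U₀ : GaugeField (F.P p.K) k (SU N) =>
        tkBranchOfRecord F N (FluctV N) θ.ν θ.τ9.M _ p.K (WtOfRecord₁₃R F N θ p) s.init (fun _ => ∅) k
          (fun ω => sect2Operand F N (FluctV N) p.K (settingOfRecord₁₃ F N θ.toStage13Params p) (θ.Rz p.K) s.init t Ek
            (UbgOfRecord₁₃CoP F N θ.toStage13Params p k s.init) ((fun _ => ∅ : ℕ → Set (Site (F.P p.K) 0)), fun j => (ω j).2) (fun j => (ω j).1))
          (baseCfg (V := FluctV N) k U₀))
    (hCB : ∀ (t : Sect2.TermValues (F.P p.K) (MatA N) (FluctV N) θ.τ9.M) (Ek : ℝ) (U₀ : GaugeField (F.P p.K) k (SU N)),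
      |tkBranchOfRecord F N (FluctV N) θ.ν θ.τ9.M _ p.K (WtOfRecord₁₃R F N θ p) s.init (fun _ => ∅) k
          (fun ω => sect2Operand F N (FluctV N) p.K (settingOfRecord₁₃ F N θ.toStage13Params p) (θ.Rz p.K) s.init t Ek
            (UbgOfRecord₁₃CoP F N θ.toStage13Params p k s.init) ((fun _ => ∅ : ℕ → Set (Site (F.P p.K) 0)), fun j => (ω j).2) (fun j => (ω j).1))
          (baseCfg (V := FluctV N) k U₀)| ≤ C)
    (t' : Sect2.TermValues (F.P p.K) (MatA N) (FluctV N) θ.τ9.M) :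
    ∃ Ek' : ℝ,
      slotsTOfRecord F N θ.ν θ.τ9 (EOfRecord₁₃ F N θ.toStage13Params) (wOfRecord₉ F N θ.toStage9Params) θ.ppSel p
          (gOfRecord₁₃ F N θ.toStage13Params p) (k + 1) s = 0 ∨
        ∀ᵐ V' ∂fieldMeasure (F.P p.K) (k + 1) (SU N),
          chiSeqOfRecord F N θ.ν θ.τ9.M (gOfRecord₁₃ F N θ.toStage13Params p) p.K (k + 1) s V' ≠ 0 →
            slotsTOfRecord F N θ.ν θ.τ9 (EOfRecord₁₃ F N θ.toStage13Params) (wOfRecord₉ F N θ.toStage9Params) θ.ppSel p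
                (gOfRecord₁₃ F N θ.toStage13Params p) (k + 1) s V' =
              sect2Slot F N (FluctV N) p.K (settingOfRecord₁₃ F N θ.toStage13Params p) (θ.Rz p.K) (WtOfRecord₁₃R F N θ p) s t' Ek'
                (UbgOfRecord₁₃CoP F N θ.toStage13Params p (k + 1) s) V' :=
  hasSect2FormAtZ_clause_succ_CoPR_of_Zr_eq_ZrOfRecord θ p hZr hk hM h.zetaUnity hS s hall ((h.tstep p k hk).measW s) hmB hCB t'

end Cured

/-! ## §3. ★★ At K0a's cured witness family `Stage13RParams.ofCured θ₀` (the K0⁶ witnesses): the v1.5 core provisos suffice -/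

section OfCured

variable (θ₀ : Stage13Params F N) (p : B12.RunParams)

/-- **★★ THE LEVEL-ONE NO-EXPANSION CONJUNCT OF `TLaw₁₃CoPR (ofCured θ₀) p 0` HOLDS FROM THE v1.5 CORE PROVISOS OF `θ₀` ALONE** (`0 < K`, `1 ≤ M`): at
K0a's cured witness over ANY v1.5 parameter `θ₀` with `Provisos₁₃Core` (rows `zetaUnity`, `measω`), for the new sequence with `Ω₁(s′) = ∅` and EVERY
term-value witness `t`, either the pre-𝐑 slot `slotT_1(s′)` vanishes or `slotT_1(s′) = 𝐓_1(s′)e^{A_1(s′)}` `dV₁`-a.e. at the run's v1.6 weights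
`WtOfRecord₁₃R (ofCured θ₀) p` and def-R's support-edition background, `E_1(s′) = E(p)` (the identity branch is what holds).  FINDING №7's cure, as a theorem
about the K0⁶ witness family. [cite: Balaban1988Convergent, Theorem p.245, (3.25) p.270, (1.11) p.248, (3.16)–(3.20) pp.268–269, (2.21)–(2.23) p.258] -/
theorem hasSect2FormAtZ_clause_one_ofCured_of_provisosCore (h : θ₀.Provisos₁₃Core F N) (hK : 0 < p.K) (hM : 1 ≤ θ₀.τ9.M)
    (s : SeqOfRecord F θ₀.ν θ₀.τ9.M (gOfRecord₁₃ F N θ₀ p) p.K 1) (hΩ : s.Ω 1 = ∅)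
    (t : Sect2.TermValues (F.P p.K) (MatA N) (FluctV N) θ₀.τ9.M) :
    slotsTOfRecord F N θ₀.ν θ₀.τ9 (EOfRecord₁₃ F N θ₀) (wOfRecord₉ F N θ₀.toStage9Params) θ₀.ppSel p (gOfRecord₁₃ F N θ₀ p) 1 s = 0 ∨
      ∀ᵐ V1 ∂fieldMeasure (F.P p.K) 1 (SU N),
        chiSeqOfRecord F N θ₀.ν θ₀.τ9.M (gOfRecord₁₃ F N θ₀ p) p.K 1 s V1 ≠ 0 →
          slotsTOfRecord F N θ₀.ν θ₀.τ9 (EOfRecord₁₃ F N θ₀) (wOfRecord₉ F N θ₀.toStage9Params) θ₀.ppSel p (gOfRecord₁₃ F N θ₀ p) 1 s V1 =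
            sect2Slot F N (FluctV N) p.K (settingOfRecord₁₃ F N θ₀ p) (θ₀.Rz p.K) (WtOfRecord₁₃R F N (Stage13RParams.ofCured F N θ₀) p) s t
              (EOfRecord₁₃ F N θ₀ p) (UbgOfRecord₁₃CoP F N θ₀ p 1 s) V1 :=
  hasSect2FormAtZ_clause_one_CoPR_of_provisos (Stage13RParams.ofCured F N θ₀) p (Stage13RParams.ofCured_Zr F N θ₀ p) h.ofCured hK hM s hΩ t

/-- **★★ THE LEVEL-(k+1) NO-EXPANSION CONJUNCT ALONG THE ALL-LARGE-FIELD HISTORY AT THE CURED WITNESS**, from the v1.5 core provisos of `θ₀`, the S-law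
`SLaw₁₃CoPR (ofCured θ₀) p k` and the displayed measurability ∕ bound of the old branch (`k < K`, `1 ≤ M`), `E_{k+1}(s′) = E_k(init s′)`.
[cite: Balaban1988Convergent, Theorem p.245, (3.24)–(3.25) p.270, (2.18) p.257, (2.20)–(2.23) p.258, (3.16)–(3.20) pp.268–269, (1.11) p.248] -/
theorem hasSect2FormAtZ_clause_succ_ofCured_of_provisosCore (h : θ₀.Provisos₁₃Core F N) {k : ℕ} (hk : k < p.K) (hM : 1 ≤ θ₀.τ9.M)
    (hS : SLaw₁₃CoPR F N (Stage13RParams.ofCured F N θ₀) p k)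
    (s : SeqOfRecord F θ₀.ν θ₀.τ9.M (gOfRecord₁₃ F N θ₀ p) p.K (k + 1)) (hall : ∀ j, 1 ≤ j → j ≤ k + 1 → s.Ω j = ∅)
    {C : ℝ}
    (hmB : ∀ (t : Sect2.TermValues (F.P p.K) (MatA N) (FluctV N) θ₀.τ9.M) (Ek : ℝ),
      Measurable fun U₀ : GaugeField (F.P p.K) k (SU N) =>
        tkBranchOfRecord F N (FluctV N) θ₀.ν θ₀.τ9.M _ p.K (WtOfRecord₁₃R F N (Stage13RParams.ofCured F N θ₀) p) s.init (fun _ => ∅) k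
          (fun ω => sect2Operand F N (FluctV N) p.K (settingOfRecord₁₃ F N θ₀ p) (θ₀.Rz p.K) s.init t Ek
            (UbgOfRecord₁₃CoP F N θ₀ p k s.init) ((fun _ => ∅ : ℕ → Set (Site (F.P p.K) 0)), fun j => (ω j).2) (fun j => (ω j).1))
          (baseCfg (V := FluctV N) k U₀))
    (hCB : ∀ (t : Sect2.TermValues (F.P p.K) (MatA N) (FluctV N) θ₀.τ9.M) (Ek : ℝ) (U₀ : GaugeField (F.P p.K) k (SU N)),
      |tkBranchOfRecord F N (FluctV N) θ₀.ν θ₀.τ9.M _ p.K (WtOfRecord₁₃R F N (Stage13RParams.ofCured F N θ₀) p) s.init (fun _ => ∅) k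
          (fun ω => sect2Operand F N (FluctV N) p.K (settingOfRecord₁₃ F N θ₀ p) (θ₀.Rz p.K) s.init t Ek
            (UbgOfRecord₁₃CoP F N θ₀ p k s.init) ((fun _ => ∅ : ℕ → Set (Site (F.P p.K) 0)), fun j => (ω j).2) (fun j => (ω j).1))
          (baseCfg (V := FluctV N) k U₀)| ≤ C)
    (t' : Sect2.TermValues (F.P p.K) (MatA N) (FluctV N) θ₀.τ9.M) :
    ∃ Ek' : ℝ,
      slotsTOfRecord F N θ₀.ν θ₀.τ9 (EOfRecord₁₃ F N θ₀) (wOfRecord₉ F N θ₀.toStage9Params) θ₀.ppSel p (gOfRecord₁₃ F N θ₀ p) (k + 1) s = 0 ∨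
        ∀ᵐ V' ∂fieldMeasure (F.P p.K) (k + 1) (SU N),
          chiSeqOfRecord F N θ₀.ν θ₀.τ9.M (gOfRecord₁₃ F N θ₀ p) p.K (k + 1) s V' ≠ 0 →
            slotsTOfRecord F N θ₀.ν θ₀.τ9 (EOfRecord₁₃ F N θ₀) (wOfRecord₉ F N θ₀.toStage9Params) θ₀.ppSel p (gOfRecord₁₃ F N θ₀ p) (k + 1) s V' =
              sect2Slot F N (FluctV N) p.K (settingOfRecord₁₃ F N θ₀ p) (θ₀.Rz p.K) (WtOfRecord₁₃R F N (Stage13RParams.ofCured F N θ₀) p) s t' Ek'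
                (UbgOfRecord₁₃CoP F N θ₀ p (k + 1) s) V' :=
  hasSect2FormAtZ_clause_succ_CoPR_of_provisos (Stage13RParams.ofCured F N θ₀) p (Stage13RParams.ofCured_Zr F N θ₀ p) h.ofCured hk hM hS s hall
    hmB hCB t'

end OfCured

end Summit.QuantumFields.YangMills.Theorems.BalabanUVNodesN11NoExpansionDiagonalCoPR

end
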